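import Summits.BirchSwinnertonDyer.Rank1Residual.ManinAdditive.AtkinLehnerDegreeLaws
import Summits.BirchSwinnertonDyer.BirchSwinnertonDyer.Theorems.ManinLocalTwoThreeFourPRootNumberMinusOne
import HarnessLib

/-!
# `N = 4p`, root number `−1`: `4 ∣ deg φ` for IV* without rational 2-torsion, mod E-es-171♯ (cone sibling of `AtkinLehnerDegreeLaws.lean`)
(cell `bsd-f2-manin`, es g36 MEMO-es §57.10, Sketch-es-g36b.lean sha16 02ac0e536502735c; typer g21 T-es-68 SPLIT BY IMPORT CONE)

This sibling holds, VERBATIM from es's Sketch-b, the one PROVED theorem that needs the `Theses.ManinLocalTwoThree` import cone: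
`four_dvd_modularDegree_fourP_of_atkinLehner_p_eq_neg` — at `N = 4p` with `w_p f = −f` the tree's `ε₄ = −1` (E-an-44,
`frickeInvolution_eq_self_of_atkinLehnerInvolutionAt_p_eq_neg` of `Theorems.ManinLocalTwoThreeFourPRootNumberMinusOne`) gives `w_N f = f`, and
E-es-171♯ `FourStarFrickePlusSharp` (leaf) gives `4 ∣ deg φ` for Kodaira IV* without rational 2-torsion (census at `N = 4p`: 425 / 425),
doubling `fourP_cusps_of_atkinLehner_p_eq_neg` (`2 ∣ deg φ`) on that class.  The rows E-es-AL / 168♯ / 169♯ / 171♯ / 172 and the other proved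
edges live in the route-independent leaf `AtkinLehnerDegreeLaws.lean`.  Same namespace `…ManinAdditive.AtkinLehnerDegree`.  Theorem-only (kind proof);
no new definitions; no sorry.  bears_on: stmt-BirchSwinnertonDyer-22967 (C2 `ManinOddAtFour`).  BSD is not proved by this; C2 OPEN.
[cite: AtkinLehner1970, Lemma 7–Thm. 3]
-/

open scoped MatrixGroups ModularForm

open CongruenceSubgroup WeierstrassCurve
open Literature.NumberTheory.EllipticCurves Literature.NumberTheory.EllipticCurves.ModularForms

open Summit.BirchSwinnertonDyer.Rank1Residual.ManinAdditive.ConwayCut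
open Summit.BirchSwinnertonDyer.Rank1Residual.ManinAdditive.JumpDegree
open Summit.BirchSwinnertonDyer.Rank1Residual.ManinAdditive.TameTwoLocal
open Summit.BirchSwinnertonDyer.BirchSwinnertonDyer.Theorems.ManinLocalTwoThree

namespace Summit.BirchSwinnertonDyer.Rank1Residual.ManinAdditive.AtkinLehnerDegree

/-- **`N = 4p`, `w_p f = −f`** (root number `−1`): E-es-171♯ and the tree's `ε₄ = −1` (E-an-44,
`frickeInvolution_eq_self_of_atkinLehnerInvolutionAt_p_eq_neg`) give `4 ∣ deg φ` for IV* without rational 2-torsion —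
doubling `fourP_cusps_of_atkinLehner_p_eq_neg` (`2 ∣ deg φ`) on that class (census at `N = 4p`: 425 / 425). -/
theorem four_dvd_modularDegree_fourP_of_atkinLehner_p_eq_neg (h171 : FourStarFrickePlusSharp)
    {p : ℕ} [NeZero (4 * p)] (hp : p.Prime) (hp2 : p ≠ 2)
    (W : WeierstrassCurve ℚ) [W.IsElliptic] [W.IsGloballyMinimal] (D : ModularParametrizationData W (4 * p))
    (hN : W.conductorNorm ℤ = 4 * p) (hIV : IsTypeFourStarAtTwoTame W) (hT : ¬ HasRationalTwoTorsion W)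
    (hε : atkinLehnerInvolutionAt (4 * p) 2 p D.f = -D.f) : 4 ∣ D.modularDegree :=
  four_dvd_modularDegree_of_fourStar_fricke_plus h171 W D hN hIV hT
    (frickeInvolution_eq_self_of_atkinLehnerInvolutionAt_p_eq_neg hp hp2 D.isNewformOf.1 hε) hp hp2
    (Dvd.intro_left 4 rfl)

end Summit.BirchSwinnertonDyer.Rank1Residual.ManinAdditive.AtkinLehnerDegree
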